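import Summits.FinalStateConjecture.FinalStateConjecture.Theorems.KerrShieldedDataExist.Negative.UnbentShieldChartFreeLemmas
import Literature.Geometry.Lorentzian.ChartCalculus
import Literature.Geometry.Lorentzian.FinalState
import Literature.Geometry.Lorentzian.KerrSliceNormalRigidity
import HarnessLib

/-!
# `KerrShieldedDataExist` — the UNBENT shield is inadmissible in every chart (`a = 0`), II: the chart-free lemma

Negative-side theorem for crux `stmt-FinalStateConjecture-10055` (standing disprover, gen 4; work file §13.4), on Part I.
**Main theorem** (`unbentShield_not_admissible_zero_spin`): NO admissible vacuum datum `D` on `E3` carries, through a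
smooth open embedding `φ` of the Kerr–Schild slice `{‖y‖ > max r₁ 0}` with compact complement of its range, the unbent
Schwarzschild slice data (`φ^*D.h = (Kerr.data M 0 r₁).h`, `φ^*D.k = (Kerr.data M 0 r₁).k`, `M > 0`) — whatever the
end structure and template mass of `admissibleVacuumData`. **Crux-shaped corollary** (`not_unbentShieldedDataExist_zero_spin`):
the body of `KerrShieldedDataExist` with `T := 0`, `a := 0` (pinned immersion `y ↦ (0, y)`, future unit normal `ν`,
pull-back identities) has no witness — the future unit normal is forced to be `Kerr.sliceNormal`
(`Kerr.eq_sliceNormalRep`), so conjunct 11 reads `φ^*D.k = Kerr.sliceK = (Kerr.data M 0 r₁).k`. Bending the shielding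
slice is therefore load-bearing ABSOLUTELY (not only in the tautological chart of `UnbentEndNotDR.lean`).

Proof of the main theorem: (i) `φ` is a local diffeomorphism because `φ^*h = h_KS ≥ δ` forces `dφ` injective
(`exists_fderivEquiv`), so its inverse `ψ` on the (open) range is differentiable with the inverse differential
(`hasFDerivAt_inverse`, Mathlib's `HasFDerivAt.of_local_left_inverse`); (ii) far out, the admissible end lies inside
`range φ` (Part I, `exists_far_inter_eq_empty` with `K = (range φ)ᶜ`); (iii) along the ray `x_t = t u` of the DR chart the
curve `γ = ψ ∘ Φ_e(x_t)` in Kerr–Schild coordinates has speed `≤ √2` (`‖γ′‖² ≤ h_KS(γ′, γ′) = hCoeff(u, u) ≤ 2`), so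
`‖γ_t‖ ≤ √2 t + c` (mean value inequality); (iv) at `γ_t` the invariant ratio on `v = γ_t` is `≥ M/(r²√(1+2M/r))`
(Part I, Kerr–Schild side) and `≤ (M/8)/t²` (Part I, DR side, through `hCoeff/kCoeff = D.h/D.k ∘ dΦ_e`), whence
`8t² ≤ r²√(1 + 2M/r) ≤ (r + 2M)² ≤ (√2 t + c₁)²`, i.e. `√2 t ≤ c₁` — false for large `t` (`[Kerr.Facts]`,
`[Kerr.SliceFacts]` are theorems of the tree: `Kerr.sliceFacts_holds`, `Kerr.*_holds`). O'Neill 1983 Ch. 4; Cook 2000.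
-/

set_option linter.dupNamespace false

noncomputable section

open Set Filter Topology Function Asymptotics Bornology
open scoped Manifold ContDiff InnerProductSpace
open Literature.Geometry.Lorentzian
open Literature.Geometry.Lorentzian.AFEnd

namespace Summit.FinalStateConjecture.FinalStateConjecture.Theorems.KerrShieldedDataExist.Negative.ChartFree

/-! ### An open embedding with `φ^*h ≥ δ` is a local diffeomorphism -/

variable {U : TopologicalSpace.Opens E3}

/-- A map out of an open subset of `E3` has a total representative. [folklore] -/
theorem exists_rep (φ : U → E3) : ∃ Φ : E3 → E3, ∀ y : U, φ y = Φ y := by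
  classical
  exact ⟨fun y ↦ if h : y ∈ U then φ ⟨y, h⟩ else 0, fun y ↦ by simp only [dif_pos y.2]⟩

/-- Auxiliary step of the chart-free unbent-shield lemma. [folklore] -/
theorem contDiffAt_rep {φ : U → E3} (hφs : ContMDiff 𝓘(ℝ, E3) (𝓡 3) ∞ φ) {Φ : E3 → E3}
    (hΦ : ∀ y : U, φ y = Φ y) (y : U) : ContDiffAt ℝ ∞ Φ y :=
  (OpensChart.contMDiffAt_iff y φ Φ hΦ).1 (hφs y)

/-- Auxiliary step of the chart-free unbent-shield lemma. [folklore] -/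
theorem mfderiv_eq_fderiv_rep {φ : U → E3} (hφs : ContMDiff 𝓘(ℝ, E3) (𝓡 3) ∞ φ) {Φ : E3 → E3}
    (hΦ : ∀ y : U, φ y = Φ y) (y : U) : mfderiv 𝓘(ℝ, E3) (𝓡 3) φ y = fderiv ℝ Φ y :=
  OpensChart.mfderiv_eq y φ Φ hΦ ((contDiffAt_rep hφs hΦ y).differentiableAt (by simp))

/-- Auxiliary step of the chart-free unbent-shield lemma. [folklore] -/
theorem hasFDerivAt_rep {φ : U → E3} (hφs : ContMDiff 𝓘(ℝ, E3) (𝓡 3) ∞ φ) {Φ : E3 → E3}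
    (hΦ : ∀ y : U, φ y = Φ y) (y : U) : HasFDerivAt Φ (fderiv ℝ Φ y) y :=
  ((contDiffAt_rep hφs hΦ y).differentiableAt (by simp)).hasFDerivAt

/-- Pull-backs along `φ` read through the representative. [folklore] -/
theorem pullbackBilin_rep {φ : U → E3} (hφs : ContMDiff 𝓘(ℝ, E3) (𝓡 3) ∞ φ) {Φ : E3 → E3}
    (hΦ : ∀ y : U, φ y = Φ y)
    (b : Π x : E3, TangentSpace (𝓡 3) x →L[ℝ] TangentSpace (𝓡 3) x →L[ℝ] ℝ) (y : U) (v w : E3) :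
    pullbackBilin (I := 𝓡 3) (I' := 𝓘(ℝ, E3)) φ b y v w = b (φ y) (fderiv ℝ Φ y v) (fderiv ℝ Φ y w) := by
  rw [pullbackBilin_apply, mfderiv_eq_fderiv_rep hφs hΦ y]
  rfl

/-- If the pull-back of some bilinear family dominates `‖v‖²`, the differential of the representative is injective,
hence a continuous linear equivalence. [folklore] -/
theorem exists_fderivEquiv {φ : U → E3} (hφs : ContMDiff 𝓘(ℝ, E3) (𝓡 3) ∞ φ) {Φ : E3 → E3}
    (hΦ : ∀ y : U, φ y = Φ y)
    (b : Π x : E3, TangentSpace (𝓡 3) x →L[ℝ] TangentSpace (𝓡 3) x →L[ℝ] ℝ) (y : U)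
    (hdom : ∀ v : E3, ‖v‖ ^ 2 ≤ pullbackBilin (I := 𝓡 3) (I' := 𝓘(ℝ, E3)) φ b y v v) :
    ∃ L : E3 ≃L[ℝ] E3, (L : E3 →L[ℝ] E3) = fderiv ℝ Φ y := by
  have hinj : Injective (fderiv ℝ Φ y) := by
    refine (injective_iff_map_eq_zero (fderiv ℝ Φ y)).2 fun v hv ↦ ?_
    have h := hdom v
    have h0 : pullbackBilin (I := 𝓡 3) (I' := 𝓘(ℝ, E3)) φ b y v v = 0 := by
      rw [pullbackBilin_rep hφs hΦ b y, hv]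
      exact (b (φ y)).map_zero₂ _
    rw [h0] at h
    have : ‖v‖ ^ 2 = 0 := le_antisymm h (sq_nonneg _)
    exact norm_eq_zero.1 (pow_eq_zero_iff (n := 2) two_ne_zero |>.1 this)
  refine ⟨(LinearMap.linearEquivOfInjective (fderiv ℝ Φ y : E3 →ₗ[ℝ] E3) hinj rfl).toContinuousLinearEquiv, ?_⟩
  ext v
  rfl

/-! ### The inverse on the range -/

/-- The inverse of the open embedding `φ` as a total map `E3 → E3`: a left inverse on `U`, a right inverse of the
representative on the range, valued in `U`, continuous on the range. [folklore] -/
theorem exists_inverse [Nonempty U] {φ : U → E3} (hφ' : IsOpenEmbedding φ) {Φ : E3 → E3} (hΦ : ∀ y : U, φ y = Φ y) :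
    ∃ ψ : E3 → E3, (∀ p ∈ range φ, Φ (ψ p) = p) ∧ (∀ p, ψ p ∈ U) ∧ (∀ p ∈ range φ, ContinuousAt ψ p) := by
  set e := hφ'.toOpenPartialHomeomorph φ with he
  refine ⟨fun p ↦ ((e.symm p : U) : E3), ?_, fun p ↦ (e.symm p).2, ?_⟩
  · rintro p ⟨y, rfl⟩
    show Φ ((e.symm (φ y) : U) : E3) = φ y
    rw [he, hφ'.toOpenPartialHomeomorph_left_inv, ← hΦ]
  · intro p hp
    have htarget : p ∈ e.target := by rw [he, hφ'.toOpenPartialHomeomorph_target]; exact hp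
    exact continuous_subtype_val.continuousAt.comp (e.continuousAt_symm htarget)

/-- **The inverse is differentiable on the range, with the inverse differential.** [folklore] -/
theorem hasFDerivAt_inverse {φ : U → E3} (hφ' : IsOpenEmbedding φ) (hφs : ContMDiff 𝓘(ℝ, E3) (𝓡 3) ∞ φ)
    {Φ : E3 → E3} (hΦ : ∀ y : U, φ y = Φ y) {ψ : E3 → E3}
    (hψΦ : ∀ p ∈ range φ, Φ (ψ p) = p) (hψU : ∀ p, ψ p ∈ U) (hψc : ∀ p ∈ range φ, ContinuousAt ψ p)
    {p : E3} (hp : p ∈ range φ) {L : E3 ≃L[ℝ] E3} (hL : (L : E3 →L[ℝ] E3) = fderiv ℝ Φ (ψ p)) :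
    HasFDerivAt ψ (L.symm : E3 →L[ℝ] E3) p := by
  refine HasFDerivAt.of_local_left_inverse (f := Φ) (hψc p hp) ?_ ?_
  · rw [hL]
    exact hasFDerivAt_rep hφs hΦ ⟨ψ p, hψU p⟩
  · filter_upwards [hφ'.isOpen_range.mem_nhds hp] with q hq
    exact hψΦ q hq

/-- **The chart-free unbent-shield lemma (`a = 0`).** No admissible vacuum datum on `E3` carries, through a smooth
open embedding `φ` of the Kerr–Schild slice with compact complement, the UNBENT Schwarzschild slice data
`(h_KS, k_KS) = ((Kerr.data M 0 r₁).h, (Kerr.data M 0 r₁).k)` — whatever the end chart of admissibility.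
[cite: Cook2000, §3.2.2 (55)–(57)] [cite: Bartnik1986, §1] -/
theorem unbentShield_not_admissible_zero_spin [Kerr.Facts] [Kerr.SliceFacts] {M : ℝ} (hM : 0 < M) {r₁ : ℝ}
    (D : InitialDataSet (𝓡 3) E3) (φ : Kerr.slice 0 r₁ → E3)
    (hφc : IsCompact (Set.range φ)ᶜ) (hφ' : IsOpenEmbedding φ)
    (hφs : ContMDiff 𝓘(ℝ, E3) (𝓡 3) ∞ φ)
    (hh : ∀ y : Kerr.slice 0 r₁, pullbackBilin (I := 𝓡 3) (I' := 𝓘(ℝ, E3)) φ D.h.inner y =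
      (Kerr.data M 0 r₁ hM.le).h.inner y)
    (hk : ∀ y : Kerr.slice 0 r₁, pullbackBilin (I := 𝓡 3) (I' := 𝓘(ℝ, E3)) φ D.k y =
      (Kerr.data M 0 r₁ hM.le).k y) :
    D ∉ admissibleVacuumData E3 := by
  intro hadm
  obtain ⟨-, e, M', hsole, hDR⟩ := mem_admissibleVacuumData_iff.mp hadm
  -- a representative and a point of the slice (nonemptiness, for the inverse)
  obtain ⟨Φ, hΦ⟩ := exists_rep φ
  haveI : Nonempty (Kerr.slice 0 r₁) := by
    refine ⟨⟨EuclideanSpace.single (0 : Fin 3) (max r₁ 0 + 1), ?_⟩⟩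
    rw [Kerr.mem_slice_zero_iff, PiLp.norm_single, Real.norm_eq_abs, abs_of_pos (by positivity)]
    linarith [le_max_right r₁ 0]
  -- pull-backs in closed form, and domination of `δ`
  have hh' : ∀ (y : Kerr.slice 0 r₁) (v w : E3), pullbackBilin (I := 𝓡 3) (I' := 𝓘(ℝ, E3)) φ D.h.inner y v w =
      Kerr.hRep M y v w := fun y v w ↦ by
    rw [hh y]; exact Kerr.data_h_inner_zero_apply M hM.le y v w
  have hk' : ∀ (y : Kerr.slice 0 r₁) (v w : E3), pullbackBilin (I := 𝓡 3) (I' := 𝓘(ℝ, E3)) φ D.k y v w =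
      Kerr.kRep M y v w := fun y v w ↦ by
    rw [hk y]; exact Kerr.data_k_zero_apply M hM.le y v w
  have hdom : ∀ (y : Kerr.slice 0 r₁) (v : E3), ‖v‖ ^ 2 ≤ pullbackBilin (I := 𝓡 3) (I' := 𝓘(ℝ, E3)) φ D.h.inner y v v :=
    fun y v ↦ by rw [hh' y v v]; exact sq_norm_le_hRep hM.le _ _
  obtain ⟨ψ, hψΦ, hψU, hψc⟩ := exists_inverse hφ' hΦ
  -- DR bounds beyond `n₁` with `ε = M/8`
  obtain ⟨n₁, hn₁⟩ := exists_radius_DR_bounds e D hDR (by positivity : 0 < M / 8)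
  -- far out, the end lies inside the image of the shield
  obtain ⟨R', hR'R, hR'⟩ := exists_far_inter_eq_empty e hφc
  have hfar : ∀ p, p ∈ e.far R' → p ∈ Set.range φ := fun p hp ↦ by
    by_contra hnp
    have : p ∈ e.far R' ∩ (Set.range φ)ᶜ := ⟨hp, hnp⟩
    rw [hR'] at this
    exact this
  -- the ray and the curve
  set n₀ : ℝ := max (max n₁ R') (max e.R 1) + 1 with hn₀
  have hn₀R : e.R < n₀ := by
    have := le_max_left e.R 1; have := le_max_right (max n₁ R') (max e.R 1); linarith
  have hn₀R' : R' < n₀ := by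
    have := le_max_right n₁ R'; have := le_max_left (max n₁ R') (max e.R 1); linarith
  have hn₀1 : n₁ ≤ n₀ := by
    have := le_max_left n₁ R'; have := le_max_left (max n₁ R') (max e.R 1); linarith
  have hn₀pos : 0 < n₀ := by
    have := le_max_right e.R 1; have := le_max_right (max n₁ R') (max e.R 1); linarith
  set u : E3 := EuclideanSpace.single (0 : Fin 3) (1 : ℝ) with hu
  have hu1 : ‖u‖ = 1 := by rw [hu, PiLp.norm_single]; simp
  have hxt : ∀ t : ℝ, 0 ≤ t → ‖t • u‖ = t := fun t ht ↦ by
    rw [norm_smul, hu1, mul_one, Real.norm_of_nonneg ht]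
  -- points of the ray beyond `n₀`
  have hray : ∀ t : ℝ, n₀ ≤ t → e.R < ‖t • u‖ ∧ n₁ ≤ ‖t • u‖ ∧ e.dataChartTotal (t • u) ∈ Set.range φ := by
    intro t ht
    have ht0 : 0 ≤ t := le_trans hn₀pos.le ht
    rw [hxt t ht0]
    refine ⟨by linarith, by linarith, hfar _ (dataChartTotal_mem_far e (by rw [hxt t ht0]; linarith) ?_)⟩
    rw [hxt t ht0]; linarith
  set γ : ℝ → E3 := fun t ↦ ψ (e.dataChartTotal (t • u)) with hγ
  have hγmem : ∀ t, γ t ∈ Kerr.slice 0 r₁ := fun t ↦ hψU _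
  have hγφ : ∀ t, n₀ ≤ t → Φ (γ t) = e.dataChartTotal (t • u) := fun t ht ↦ hψΦ _ (hray t ht).2.2
  -- derivative of the curve and its speed
  have hderiv : ∀ t, n₀ ≤ t → ∃ γ' : E3, HasDerivAt γ γ' t ∧ ‖γ'‖ ^ 2 ≤ 2 := by
    intro t ht
    obtain ⟨hxR, hx1, hxr⟩ := hray t ht
    set x : E3 := t • u with hxdef
    set p : E3 := e.dataChartTotal x with hpdef
    set yS : Kerr.slice 0 r₁ := ⟨ψ p, hψU p⟩ with hyS
    obtain ⟨L, hL⟩ := exists_fderivEquiv hφs hΦ D.h.inner yS (hdom yS)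
    have hinv : HasFDerivAt ψ (L.symm : E3 →L[ℝ] E3) p := hasFDerivAt_inverse hφ' hφs hΦ hψΦ hψU hψc hxr hL
    have hdct : HasFDerivAt e.dataChartTotal (fderiv ℝ e.dataChartTotal x) x :=
      ((contDiffAt_dataChartTotal e hxR).differentiableAt (by simp)).hasFDerivAt
    have hlin : HasDerivAt (fun s : ℝ ↦ s • u) u t := by
      simpa using (hasDerivAt_id t).smul_const u
    have hcomp : HasDerivAt γ ((L.symm : E3 →L[ℝ] E3) (fderiv ℝ e.dataChartTotal x u)) t := by
      have := (hinv.comp_hasDerivAt t (hdct.comp_hasDerivAt t hlin))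
      exact this
    refine ⟨_, hcomp, ?_⟩
    -- speed: ‖γ'‖² ≤ h_KS(γ', γ') = h(p)(w, w) = hCoeff x u u ≤ 2
    set w : E3 := fderiv ℝ e.dataChartTotal x u with hw
    have hLw : fderiv ℝ Φ yS ((L.symm : E3 →L[ℝ] E3) w) = w := by
      have : (L : E3 →L[ℝ] E3) ((L.symm : E3 →L[ℝ] E3) w) = w := L.apply_symm_apply w
      rwa [hL] at this
    have h1 := hdom yS ((L.symm : E3 →L[ℝ] E3) w)
    rw [pullbackBilin_rep hφs hΦ D.h.inner yS, hLw] at h1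
    have hφy : φ yS = p := by rw [hΦ yS]; exact hψΦ _ hxr
    rw [hφy] at h1
    have h2 : D.h.inner p w w = AFEnd.hCoeff e D x u u := by rw [hCoeff_eq_fderiv e D hxR]
    have h3 := (hn₁ x hx1 u).1
    rw [hu1] at h3
    calc ‖(L.symm : E3 →L[ℝ] E3) w‖ ^ 2 ≤ D.h.inner p w w := h1
      _ = AFEnd.hCoeff e D x u u := h2
      _ ≤ 2 * 1 ^ 2 := h3
      _ = 2 := by norm_num
  -- growth of the curve: ‖γ t‖ ≤ ‖γ n₀‖ + √2 (t − n₀)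
  have hgrowth : ∀ t, n₀ ≤ t → ‖γ t - γ n₀‖ ≤ Real.sqrt 2 * (t - n₀) := by
    intro t ht
    choose! γ' hγ' using hderiv
    have hf : ∀ s ∈ Set.Icc n₀ t, HasDerivWithinAt γ (γ' s) (Set.Icc n₀ t) s :=
      fun s hs ↦ (hγ' s hs.1).1.hasDerivWithinAt
    have hbound : ∀ s ∈ Set.Ico n₀ t, ‖γ' s‖ ≤ Real.sqrt 2 := fun s hs ↦ by
      have := (hγ' s hs.1).2
      rw [← Real.sqrt_le_sqrt_iff (by norm_num : (0:ℝ) ≤ 2)] at this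
      rwa [Real.sqrt_sq (norm_nonneg _)] at this
    exact norm_image_sub_le_of_norm_deriv_le_segment' hf hbound t ⟨ht, le_rfl⟩
  -- choose the parameter
  set c₁ : ℝ := ‖γ n₀‖ + Real.sqrt 2 * n₀ + 2 * M with hc₁
  set t : ℝ := max n₀ (c₁ + 1) with htdef
  have htn₀ : n₀ ≤ t := le_max_left _ _
  have htc : c₁ < t := by have := le_max_right n₀ (c₁ + 1); linarith
  have ht0 : 0 < t := lt_of_lt_of_le hn₀pos htn₀
  obtain ⟨hxR, hx1, hxr⟩ := hray t htn₀
  set x : E3 := t • u with hxdef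
  set p : E3 := e.dataChartTotal x with hpdef
  set yS : Kerr.slice 0 r₁ := ⟨γ t, hγmem t⟩ with hyS
  have hyv : (yS : E3) = γ t := rfl
  have hy0 : (yS : E3) ≠ 0 := Kerr.ne_zero_of_mem_slice_zero yS
  -- the identification of the two readings of `k/h` on the vector `y⃗ = γ t`
  obtain ⟨L, hL⟩ := exists_fderivEquiv hφs hΦ D.h.inner yS (hdom yS)
  have hφy : φ yS = p := by
    rw [hΦ yS, hyv]
    exact hγφ t htn₀
  have hpU : p ∈ (e.U : Set E3) := by rw [hpdef]; exact dataChartTotal_mem x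
  have hxp : e.chartExt p = x := chartExt_dataChartTotal hxR
  set w' : E3 := fderiv ℝ e.chartExt p ((L : E3 →L[ℝ] E3) (γ t)) with hw'
  have hDw' : fderiv ℝ e.dataChartTotal x w' = (L : E3 →L[ℝ] E3) (γ t) := by
    rw [hw', ← hxp]
    exact fderiv_dataChartTotal_comp_chartExt e hpU _
  have hK : AFEnd.kCoeff e D x w' w' = Kerr.kRep M (γ t) (γ t) (γ t) := by
    rw [kCoeff_eq_fderiv e D hxR, hDw', ← hk' yS, pullbackBilin_rep hφs hΦ D.k yS, hφy, hL]
  have hH : AFEnd.hCoeff e D x w' w' = Kerr.hRep M (γ t) (γ t) (γ t) := by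
    rw [hCoeff_eq_fderiv e D hxR, hDw', ← hh' yS, pullbackBilin_rep hφs hΦ D.h.inner yS, hφy, hL]
  -- Lemma B at x (‖x‖ = t ≥ n₁)
  have hB := (hn₁ x hx1 w').2
  rw [hK, hH, hxdef, hxt t ht0.le] at hB
  -- Lemma A′ (division-free) at γ t
  have hA := mul_hRep_le hM hy0
  rw [hyv] at hA
  -- h > 0
  have hHpos : 0 < Kerr.hRep M (γ t) (γ t) (γ t) := by
    have := sq_norm_le_hRep hM.le (γ t) (γ t)
    have : 0 < ‖γ t‖ ^ 2 := by rw [← hyv]; positivity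
    linarith
  -- combine: M h ≤ r² S k ≤ r² S (M/8)/t² h  ⇒  8 t² ≤ r² S ≤ (r + 2M)²
  set r : ℝ := ‖γ t‖ with hrdef
  have hr0 : 0 < r := by rw [hrdef, ← hyv]; exact norm_pos_iff.2 hy0
  set S : ℝ := √(1 + 2 * M / r) with hSdef
  have hS0 : 0 ≤ r ^ 2 * S := by positivity
  have hkabs : Kerr.kRep M (γ t) (γ t) (γ t) ≤ M / 8 / t ^ 2 * Kerr.hRep M (γ t) (γ t) (γ t) :=
    le_trans (le_abs_self _) hB
  have hchain : M * Kerr.hRep M (γ t) (γ t) (γ t) ≤ r ^ 2 * S * (M / 8 / t ^ 2) * Kerr.hRep M (γ t) (γ t) (γ t) := by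
    calc M * Kerr.hRep M (γ t) (γ t) (γ t) ≤ r ^ 2 * S * Kerr.kRep M (γ t) (γ t) (γ t) := hA
      _ ≤ r ^ 2 * S * (M / 8 / t ^ 2 * Kerr.hRep M (γ t) (γ t) (γ t)) :=
          mul_le_mul_of_nonneg_left hkabs hS0
      _ = r ^ 2 * S * (M / 8 / t ^ 2) * Kerr.hRep M (γ t) (γ t) (γ t) := by ring
  have h8 : 8 * t ^ 2 ≤ r ^ 2 * S := by
    have := le_of_mul_le_mul_right hchain hHpos
    rw [div_div, ← mul_div_assoc, le_div_iff₀ (by positivity : (0:ℝ) < 8 * t ^ 2)] at this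
    have h'' : M * (8 * t ^ 2) ≤ M * (r ^ 2 * S) := by
      calc M * (8 * t ^ 2) ≤ r ^ 2 * S * M := this
        _ = M * (r ^ 2 * S) := by ring
    exact le_of_mul_le_mul_left h'' hM
  have hrS : r ^ 2 * S ≤ (r + 2 * M) ^ 2 := sq_mul_sqrt_le hM.le hr0
  -- r ≤ ‖γ n₀‖ + √2 (t − n₀) ≤ c₁ − 2M − √2 n₀ + √2 t + ... : r + 2M ≤ √2 t + c₁' with c₁' = ‖γ n₀‖ + 2M
  have hrle : r ≤ ‖γ n₀‖ + Real.sqrt 2 * (t - n₀) := by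
    calc r = ‖γ t‖ := rfl
      _ = ‖(γ t - γ n₀) + γ n₀‖ := by rw [sub_add_cancel]
      _ ≤ ‖γ t - γ n₀‖ + ‖γ n₀‖ := norm_add_le _ _
      _ ≤ Real.sqrt 2 * (t - n₀) + ‖γ n₀‖ := by linarith [hgrowth t htn₀]
      _ = ‖γ n₀‖ + Real.sqrt 2 * (t - n₀) := by ring
  have hs2 : Real.sqrt 2 ^ 2 = 2 := Real.sq_sqrt (by norm_num)
  have hs2pos : 0 < Real.sqrt 2 := Real.sqrt_pos.2 (by norm_num)
  -- 8 t² ≤ (r + 2M)² ≤ (√2 t + c₁ − √2 n₀)² ≤ (√2 t + c₁)²; take square roots: 2√2 t ≤ √2 t + c₁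
  have hbig : 8 * t ^ 2 ≤ (Real.sqrt 2 * t + c₁) ^ 2 := by
    have h1 : r + 2 * M ≤ Real.sqrt 2 * t + c₁ := by
      have h0 : 0 ≤ Real.sqrt 2 * n₀ := by positivity
      have e1 : Real.sqrt 2 * (t - n₀) = Real.sqrt 2 * t - Real.sqrt 2 * n₀ := by ring
      rw [hc₁]; linarith [hrle, e1, h0]
    have h2 : 0 ≤ r + 2 * M := by positivity
    calc 8 * t ^ 2 ≤ r ^ 2 * S := h8
      _ ≤ (r + 2 * M) ^ 2 := hrS
      _ ≤ (Real.sqrt 2 * t + c₁) ^ 2 := by gcongr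
  -- (2√2 t)² = 8t² ≤ (√2 t + c₁)² with both bases ≥ 0 ⇒ 2√2 t ≤ √2 t + c₁ ⇒ √2 t ≤ c₁ < t ≤ √2 t: contradiction
  have hc₁pos : 0 ≤ c₁ := by rw [hc₁]; positivity
  have hbase : 2 * Real.sqrt 2 * t ≤ Real.sqrt 2 * t + c₁ := by
    have hl : 0 ≤ 2 * Real.sqrt 2 * t := by positivity
    have hr' : 0 ≤ Real.sqrt 2 * t + c₁ := by positivity
    have : (2 * Real.sqrt 2 * t) ^ 2 ≤ (Real.sqrt 2 * t + c₁) ^ 2 := by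
      calc (2 * Real.sqrt 2 * t) ^ 2 = 8 * t ^ 2 := by rw [mul_pow, mul_pow, hs2]; ring
        _ ≤ (Real.sqrt 2 * t + c₁) ^ 2 := hbig
    have hsq := Real.sqrt_le_sqrt this
    rwa [Real.sqrt_sq hl, Real.sqrt_sq hr'] at hsq
  have hfin : Real.sqrt 2 * t ≤ c₁ := by linarith
  have h1lt : (1:ℝ) < Real.sqrt 2 := by
    rw [show (1:ℝ) = Real.sqrt 1 by simp]
    exact Real.sqrt_lt_sqrt (by norm_num) (by norm_num)
  have : t < Real.sqrt 2 * t := lt_mul_of_one_lt_left ht0 h1lt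
  linarith

/-- **The crux with the bend removed is FALSE (`a = 0`).** The body of `KerrShieldedDataExist` with `T := 0` (so the pinned
immersion is the Kerr–Schild slice `y ↦ (0, y)` itself) and `a := 0` has no witness: bending the shielding slice is
load-bearing. (The window conjuncts `|a| < M`, `r₋ < r₁ < r₊` and the spacelike clause are dropped — the statement
refuted here is weaker than the crux-with-`T = 0`, hence the refutation stronger.) [cite: Cook2000, §3.2.2] -/
theorem not_unbentShieldedDataExist_zero_spin [Kerr.Facts] [Kerr.SliceFacts] :
    ¬ ∃ D ∈ admissibleVacuumData E3, ∃ (M r₁ : ℝ) (hM : 0 ≤ M) (φ : Kerr.slice 0 r₁ → E3)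
        (ψ : Kerr.slice 0 r₁ → Kerr.region 0 r₁) (ν : NormalField 𝓘(ℝ, E4) ψ),
        0 < M ∧ IsCompact (Set.range φ)ᶜ ∧ IsOpenEmbedding φ ∧ ContMDiff 𝓘(ℝ, E3) (𝓡 3) ∞ φ ∧
        (∀ y : Kerr.slice 0 r₁, (ψ y : E4) = E4.ofTimeSpace 0 (y : E3)) ∧
        (Kerr.smoothMetric M 0 r₁).IsFutureUnitNormal 𝓘(ℝ, E3)
          ((Kerr.timeOrientation M 0 r₁ hM).ofLE le_top) ψ ν ∧
        (∀ y : Kerr.slice 0 r₁, pullbackBilin (I := 𝓡 3) (I' := 𝓘(ℝ, E3)) φ D.h.inner y =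
          pullbackBilin (I := 𝓘(ℝ, E4)) (I' := 𝓘(ℝ, E3)) ψ (Kerr.smoothMetric M 0 r₁).val y) ∧
        (∀ [(Kerr.smoothMetric M 0 r₁).HasLeviCivita] (y : Kerr.slice 0 r₁),
          (pullbackBilin (I := 𝓡 3) (I' := 𝓘(ℝ, E3)) φ D.k y).toLinearMap₁₂ =
            (Kerr.smoothMetric M 0 r₁).secondFundamentalForm 𝓘(ℝ, E3) ψ ν y) := by
  rintro ⟨D, hadm, M, r₁, hM, φ, ψ, ν, hMpos, hφc, hφ', hφs, hψ, hν, hh, hk⟩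
  have hψeq : ψ = Kerr.sliceEmbed 0 r₁ := funext fun y ↦ Subtype.ext (hψ y)
  subst hψeq
  -- the future unit normal of the slice is unique: `ν = Kerr.sliceNormal M 0 r₁`
  have hνeq : ν = Kerr.sliceNormal M 0 r₁ := by
    funext y
    have hy : (y : E3) ≠ 0 := Kerr.ne_zero_of_mem_slice_zero y
    rw [Kerr.sliceNormal_zero_eq M r₁ y]
    refine Kerr.eq_sliceNormalRep hM hy (fun w ↦ ?_) ?_ ?_
    · have := hν.1.1 y w
      rwa [Kerr.smoothMetric_val, Kerr.mfderiv_sliceEmbed_apply] at this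
    · have := hν.1.2 y
      rwa [Kerr.smoothMetric_val] at this
    · exact (hν.2 y).2
  subst hνeq
  have hh' : ∀ y : Kerr.slice 0 r₁, pullbackBilin (I := 𝓡 3) (I' := 𝓘(ℝ, E3)) φ D.h.inner y =
      (Kerr.data M 0 r₁ hM).h.inner y := fun y ↦ by
    rw [hh y, Kerr.data_h_inner]
    rfl
  have hk' : ∀ y : Kerr.slice 0 r₁, pullbackBilin (I := 𝓡 3) (I' := 𝓘(ℝ, E3)) φ D.k y =
      (Kerr.data M 0 r₁ hM).k y := fun y ↦ by
    ext v w
    have h1 : (pullbackBilin (I := 𝓡 3) (I' := 𝓘(ℝ, E3)) φ D.k y).toLinearMap₁₂ v w =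
        ((Kerr.smoothMetric M 0 r₁).secondFundamentalForm 𝓘(ℝ, E3) (Kerr.sliceEmbed 0 r₁)
          (Kerr.sliceNormal M 0 r₁) y) v w := by rw [hk y]
    change pullbackBilin (I := 𝓡 3) (I' := 𝓘(ℝ, E3)) φ D.k y v w = _ at h1
    rw [h1, Kerr.data_k, Kerr.sliceK_apply]
  exact unbentShield_not_admissible_zero_spin hMpos D φ hφc hφ' hφs hh' hk' hadm

end Summit.FinalStateConjecture.FinalStateConjecture.Theorems.KerrShieldedDataExist.Negative.ChartFree

end
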